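import Mathlib.Geometry.Manifold.ChartedSpace
import Mathlib.Analysis.InnerProductSpace.PiL2
import Mathlib.AlgebraicTopology.FundamentalGroupoid.SimplyConnected
import Mathlib.Data.ZMod.Basic
import Literature.AlgebraicTopology.SingularHomology.RelativeHomology
import HarnessLib

-- provenance: harness21/H21/H21/Prelude/AlgTop/Orientation.lean @ 884d84e (interim HEAD d8f2665); M5 mechanical rewrite
/-!
# Local homology and homological orientations (trunk G04 AlgTop, item C8 `Orientation`)

For a topological space `X`, a subset `K ⊆ X` and a point `x : X` we define the *local homology*
modules `Hₙ(X | K; M) := Hₙ(X, X ∖ K; M)` and `Hₙ(X | x; M) := Hₙ(X, X ∖ {x}; M)` together with the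
restriction maps `Hₙ(X | K) ⟶ Hₙ(X | L)` for `L ⊆ K`, and the triangulation-free notion of an
`R`-orientation of a topological `n`-manifold: a choice of generator `μₓ ∈ Hₙ(X | x; R)` at every
point which is *locally consistent*, i.e. locally the restriction of a single class on a
neighbourhood (A. Hatcher, *Algebraic Topology*, CUP 2002, §3.3, pp. 233–236).

Mathlib (pinned) has no relative singular homology, no local homology and no orientation of
topological manifolds (`rg Orientation Mathlib/AlgebraicTopology Mathlib/Geometry/Manifold`: only
orientations of real vector spaces / smooth atlases, `Mathlib.LinearAlgebra.Orientation`,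
which is a different notion). Everything here is a thin layer over
`Literature.AlgebraicTopology.SingularHomology.relativeSingularHomology` (item C2).

## Conventions

As in `Literature.Prelude.AlgTop.SingularChains`: `X : Type u` unbundled, coefficients `R : Type v`
`[CommRing R]`, `M : Type v` an `R`-module, all objects in `ModuleCat.{max u v} R`.
Topological `n`-manifolds are `[T2Space X] [ChartedSpace (EuclideanSpace ℝ (Fin n)) X]`, exactly as
in `Mathlib/Geometry/Manifold/PoincareConjecture.lean`; these hypotheses appear on *theorems only*.

## Main definitions

* `Literature.localHomologyOfSet R M X K n := Hₙ(X, Kᶜ; M)` and `Literature.localHomology R M X x n := Hₙ(X, {x}ᶜ; M)`.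
* `Literature.restrictLocal (h : L ⊆ K) n : Hₙ(X | K) ⟶ Hₙ(X | L)` and `Literature.restrictToPoint (hx : x ∈ K) n`,
  induced by the identity as a map of pairs `(X, Kᶜ) → (X, Lᶜ)`.
* `Literature.localHomology.mapIso (e : X ≃ₜ Y) x n : Hₙ(X | x) ≅ Hₙ(Y | e x)`.
* `Literature.HomologicalOrientation R X n`: a locally consistent choice of generators of `Hₙ(X | x; R)`
  (Hatcher 2002, p. 235), with `neg` (the opposite orientation) and `comap` (transport along a
  homeomorphism); `Literature.IsOrientableOver R X n := Nonempty (HomologicalOrientation R X n)`.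

## Main statements (proofs deferred)

* `Literature.AlgebraicTopology.SingularHomology.nonempty_localHomology_iso`, `Literature.AlgebraicTopology.SingularHomology.isZero_localHomology`: `Hₙ(X | x; R) ≅ R` and
  `Hₖ(X | x) = 0` for `k ≠ n` on a topological `n`-manifold (Hatcher 2002, p. 231).
* `Literature.AlgebraicTopology.SingularHomology.isOrientableOver_zmod_two`, `Literature.AlgebraicTopology.SingularHomology.isOrientableOver_int_of_simplyConnectedSpace`,
  `Literature.AlgebraicTopology.SingularHomology.HomologicalOrientation.ext_of_connected`, `Literature.AlgebraicTopology.SingularHomology.HomologicalOrientation.eq_or_eq_neg_of_connected`,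
  `Literature.AlgebraicTopology.SingularHomology.isOrientableOver_of_int` (Hatcher 2002, pp. 234–235, Prop. 3.25 and the remarks around it).

## Main statements (proved, appended section "Proofs")

* `Literature.AlgebraicTopology.SingularHomology.isIso_restrictLocal_of_retract`: `Hₙ(X | K) ⟶ Hₙ(X | L)` is an isomorphism when `X ∖ K`
  is a (weak) deformation retract of `X ∖ L` (long exact sequences + five lemma + homotopy
  invariance; no excision needed).
* `Literature.AlgebraicTopology.SingularHomology.exists_isOpen_retract_compl`, `Literature.AlgebraicTopology.SingularHomology.exists_isOpen_isIso_restrictToPoint`: chart balls `B`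
  about `x` with `X ∖ B` a deformation retract of `X ∖ {x}`, hence `Hₖ(X | B) ≅ Hₖ(X | x)`
  (Hatcher 2002, p. 234).
* `Literature.AlgebraicTopology.SingularHomology.HomologicalOrientation.exists_isUnit_smul`, `eventually_eq_smul` (unique continuation),
  `ext_of_connected_holds : ext_of_connected R`, `eq_or_eq_neg_of_isUnit_imp` and
  `eq_or_eq_neg_of_connected_holds : eq_or_eq_neg_of_connected` (Hatcher 2002, pp. 234–235,
  proof of Prop. 3.25).

## Design notes

There is deliberately no restriction map along an open embedding `U ↪ X` (`restrictOpens`): it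
would require the *data* of the excision isomorphism; nothing downstream uses it.
-/

noncomputable section

open CategoryTheory Limits Topology

universe u v

namespace Literature.AlgebraicTopology.SingularHomology

variable (R : Type v) [CommRing R] (M : Type v) [AddCommGroup M] [Module R M]
variable {X Y Z : Type u} [TopologicalSpace X] [TopologicalSpace Y] [TopologicalSpace Z]

/-! ### Local homology -/

variable (X) in
/-- The local homology `Hₙ(X | K; M) := Hₙ(X, X ∖ K; M)` of `X` at a subset `K`
(Hatcher 2002, §3.3, p. 233, notation `Hₙ(X | A)`). [cite: Hatcher2002, §3.3  p. 233  notation  Hₙ(X | A] -/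
abbrev localHomologyOfSet (K : Set X) (n : ℕ) : ModuleCat.{max u v} R :=
  relativeSingularHomology R M X Kᶜ n

variable (X) in
/-- The local homology `Hₙ(X | x; M) := Hₙ(X, X ∖ {x}; M)` of `X` at a point `x`
(Hatcher 2002, §3.3, p. 231). [cite: Hatcher2002, §3.3  p. 231] -/
abbrev localHomology (x : X) (n : ℕ) : ModuleCat.{max u v} R :=
  localHomologyOfSet R M X {x} n

/-- The restriction map `Hₙ(X | K; M) ⟶ Hₙ(X | L; M)` for `L ⊆ K`, induced by the identity of `X`
viewed as a map of pairs `(X, X ∖ K) → (X, X ∖ L)` (Hatcher 2002, §3.3, p. 233). [cite: Hatcher2002, §3.3  p. 233] -/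
def restrictLocal {K L : Set X} (h : L ⊆ K) (n : ℕ) :
    localHomologyOfSet R M X K n ⟶ localHomologyOfSet R M X L n :=
  relativeSingularHomology.map R M (ContinuousMap.id X) (fun _ hx ↦ Set.compl_subset_compl.2 h hx) n

/-- The restriction map `Hₙ(X | K; M) ⟶ Hₙ(X | x; M)` for `x ∈ K` (Hatcher 2002, §3.3, p. 233,
the maps `Hₙ(M | B) → Hₙ(M | y)`). [cite: Hatcher2002, §3.3  p. 233  the maps  Hₙ(M | B] -/
abbrev restrictToPoint {K : Set X} {x : X} (hx : x ∈ K) (n : ℕ) :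
    localHomologyOfSet R M X K n ⟶ localHomology R M X x n :=
  restrictLocal R M (Set.singleton_subset_iff.2 hx) n

/-- Restricting to the same set is the identity (Hatcher 2002, §3.3). [cite: Hatcher2002, §3.3] -/
@[simp]
lemma restrictLocal_self (K : Set X) (n : ℕ) : restrictLocal R M (subset_refl K) n = 𝟙 _ :=
  relativeSingularHomology.map_id R M Kᶜ n

/-- Restriction maps compose: `Hₙ(X | K) ⟶ Hₙ(X | L) ⟶ Hₙ(X | N)` is the restriction
`Hₙ(X | K) ⟶ Hₙ(X | N)` (Hatcher 2002, §3.3). [cite: Hatcher2002, §3.3] -/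
@[reassoc (attr := simp)]
lemma restrictLocal_comp {K L N : Set X} (hLK : L ⊆ K) (hNL : N ⊆ L) (n : ℕ) :
    restrictLocal R M hLK n ≫ restrictLocal R M hNL n = restrictLocal R M (hNL.trans hLK) n := by
  rw [restrictLocal, restrictLocal, ← relativeSingularHomology.map_comp]
  rfl

namespace localHomology

/-- A homeomorphism `e : X ≃ₜ Y` induces `Hₙ(X | x; M) ≅ Hₙ(Y | e x; M)`, since it is an
isomorphism of pairs `(X, X ∖ {x}) → (Y, Y ∖ {e x})` (Hatcher 2002, §3.3, p. 231: local homology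
depends only on the local topology). [cite: Hatcher2002, §3.3  p. 231: local homology depends onl] -/
def mapIso (e : X ≃ₜ Y) (x : X) (n : ℕ) : localHomology R M X x n ≅ localHomology R M Y (e x) n where
  hom := relativeSingularHomology.map R M (e : C(X, Y))
    (show Set.MapsTo e {x}ᶜ {e x}ᶜ from
      fun y hy h ↦ hy (e.injective (Set.mem_singleton_iff.1 h))) n
  inv := relativeSingularHomology.map R M (e.symm : C(Y, X))
    (show Set.MapsTo e.symm {e x}ᶜ {x}ᶜ from
      fun y hy h ↦ hy (by rw [Set.mem_singleton_iff] at h ⊢; rw [← h, e.apply_symm_apply])) n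
  hom_inv_id := by
    rw [← relativeSingularHomology.map_comp, ← relativeSingularHomology.map_id]
    congr 1
    ext
    simp
  inv_hom_id := by
    rw [← relativeSingularHomology.map_comp, ← relativeSingularHomology.map_id]
    congr 1
    ext
    simp

end localHomology

/-! ### Local homology of topological manifolds -/

/-- On a topological `n`-manifold, `Hₙ(X | x; R) ≅ R` for every point `x`
(Hatcher 2002, §3.3, p. 231: `Hₙ(M | x) ≅ Hₙ(ℝⁿ | 0) ≅ H̃ₙ₋₁(Sⁿ⁻¹)` by excision and the long
exact sequence). [cite: Hatcher2002, §3.3  p. 231:  Hₙ(M | x] -/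
def nonempty_localHomology_iso : Prop :=
  ∀ {n : ℕ} [T2Space X] [ChartedSpace (EuclideanSpace ℝ (Fin n)) X] (x : X),
    Nonempty (localHomology R R X x n ≅ ModuleCat.of R (ULift.{u} R))

/-- On a topological `n`-manifold, `Hₖ(X | x; M) = 0` for `k ≠ n`
(Hatcher 2002, §3.3, p. 231: `Hₖ(M | x) ≅ H̃ₖ₋₁(Sⁿ⁻¹)`). [cite: Hatcher2002, §3.3  p. 231:  Hₖ(M | x] -/
def isZero_localHomology : Prop :=
  ∀ {n : ℕ} [T2Space X] [ChartedSpace (EuclideanSpace ℝ (Fin n)) X] (x : X) {k : ℕ} (hk : k ≠ n),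
    IsZero (localHomology R M X x k)

/-! ### Homological orientations -/

/-- A (homological) `R`-orientation of `X` in dimension `n` (Hatcher 2002, §3.3, p. 235,
"`R`-orientation"): a function `x ↦ μₓ` assigning to each point a generator `μₓ` of the
`R`-module `Hₙ(X | x; R)` (i.e. an element corresponding to a unit under some, hence any,
`R`-linear identification `Hₙ(X | x; R) ≃ R`), subject to *local consistency*: every point has a
neighbourhood `K` and a class `μ_K ∈ Hₙ(X | K; R)` restricting to `μ_y` for all `y ∈ K`
(equivalent to Hatcher's formulation with balls in charts).

The structure is stated for an arbitrary space `X` and an arbitrary `n : ℕ` (manifold hypotheses are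
put on theorems only); it is only meaningful when `X` is a topological `n`-manifold,
`[T2Space X] [ChartedSpace (EuclideanSpace ℝ (Fin n)) X]`, with `n` the chart dimension. [cite: Hatcher2002, §3.3  p. 235  " R -orientation"] -/
@[ext]
structure HomologicalOrientation (R : Type v) [CommRing R] (X : Type u) [TopologicalSpace X]
    (n : ℕ) where
  /-- The local orientation class `μₓ ∈ Hₙ(X | x; R)` at each point. -/
  localClass : ∀ x : X, localHomology R R X x n
  /-- Each `μₓ` is a generator: it corresponds to `1` under some `R`-linear iso `Hₙ(X | x; R) ≃ R`. -/
  isGenerator : ∀ x : X, ∃ e : localHomology R R X x n ≃ₗ[R] R, e (localClass x) = 1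
  /-- Local consistency: near each point the `μ_y` are restrictions of one class `μ_K`. -/
  locallyConsistent : ∀ x : X, ∃ K ∈ 𝓝 x, ∃ μK : localHomologyOfSet R R X K n,
    ∀ y (hy : y ∈ K), restrictToPoint R R hy n μK = localClass y

namespace HomologicalOrientation

variable {R} {n : ℕ}

/-- The opposite orientation `x ↦ -μₓ` (Hatcher 2002, §3.3, p. 234: "reversing all the local
orientations"). [cite: Hatcher2002, §3.3  p. 234: "reversing all the local o] -/
protected def neg (μ : HomologicalOrientation R X n) : HomologicalOrientation R X n where
  localClass x := -μ.localClass x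
  isGenerator x := by
    obtain ⟨e, he⟩ := μ.isGenerator x
    exact ⟨e.trans (LinearEquiv.neg R), by simp [he]⟩
  locallyConsistent x := by
    obtain ⟨K, hK, μK, hμK⟩ := μ.locallyConsistent x
    exact ⟨K, hK, -μK, fun y hy ↦ by rw [map_neg, hμK y hy]⟩

/-- Notation `-μ` for the opposite orientation `HomologicalOrientation.neg μ`
(Hatcher 2002, §3.3, p. 234). [cite: Hatcher2002, §3.3  p. 234] -/
instance : Neg (HomologicalOrientation R X n) := ⟨HomologicalOrientation.neg⟩

/-- `(-μ)ₓ = -μₓ` (Hatcher 2002, §3.3, p. 234). [cite: Hatcher2002, §3.3  p. 234] -/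
@[simp]
lemma neg_localClass (μ : HomologicalOrientation R X n) (x : X) :
    (-μ).localClass x = -μ.localClass x := rfl

/-- Reversing an orientation twice gives it back: `-(-μ) = μ` (Hatcher 2002, §3.3, p. 234). [cite: Hatcher2002, §3.3  p. 234] -/
instance : InvolutiveNeg (HomologicalOrientation R X n) where
  neg_neg μ := by ext x; simp

/-- Transport of an orientation of `X` along a homeomorphism `e : Y ≃ₜ X`: the orientation of `Y`
whose local class at `y` is the image of `μ_{e y}` under `(e⁻¹)_* : Hₙ(X | e y) ⟶ Hₙ(Y | y)`
(Hatcher 2002, §3.3; orientations are natural under homeomorphisms). [cite: Hatcher2002, §3.3] -/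
def comap (μ : HomologicalOrientation R X n) (e : Y ≃ₜ X) : HomologicalOrientation R Y n where
  localClass y := (localHomology.mapIso R R e y n).inv (μ.localClass (e y))
  isGenerator y := by
    obtain ⟨f, hf⟩ := μ.isGenerator (e y)
    refine ⟨(localHomology.mapIso R R e y n).toLinearEquiv.trans f, ?_⟩
    simp only [LinearEquiv.trans_apply, Iso.toLinearEquiv_apply]
    rw [← ModuleCat.comp_apply, Iso.inv_hom_id, ModuleCat.id_apply, hf]
  locallyConsistent y := by
    obtain ⟨K, hK, μK, hμK⟩ := μ.locallyConsistent (e y)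
    refine ⟨e ⁻¹' K, e.continuous.continuousAt.preimage_mem_nhds hK,
      relativeSingularHomology.map R R (e.symm : C(X, Y))
        (show Set.MapsTo e.symm Kᶜ (e ⁻¹' K)ᶜ from fun z hz h ↦ hz (by simpa using h)) n μK,
      fun z hz ↦ ?_⟩
    rw [← hμK (e z) hz, localHomology.mapIso, restrictToPoint, restrictLocal, restrictToPoint,
      restrictLocal, ← ModuleCat.comp_apply, ← ModuleCat.comp_apply,
      ← relativeSingularHomology.map_comp, ← relativeSingularHomology.map_comp]
    rfl

/-- `(μ.comap e)_y = (e⁻¹)_* μ_{e y}` (Hatcher 2002, §3.3). [cite: Hatcher2002, §3.3] -/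
@[simp]
lemma comap_localClass (μ : HomologicalOrientation R X n) (e : Y ≃ₜ X) (y : Y) :
    (μ.comap e).localClass y = (localHomology.mapIso R R e y n).inv (μ.localClass (e y)) := rfl

end HomologicalOrientation

/-! ### Orientability -/

variable (X) in
/-- `X` is `R`-orientable in dimension `n` if it admits a homological `R`-orientation
(Hatcher 2002, §3.3, p. 235, "`R`-orientable"). Only meaningful for a topological `n`-manifold. [cite: Hatcher2002, §3.3  p. 235  " R -orientable"] -/
def IsOrientableOver (n : ℕ) : Prop :=
  Nonempty (HomologicalOrientation R X n)

/-- Every topological `n`-manifold is `ℤ/2`-orientable (Hatcher 2002, §3.3, p. 235: "every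
manifold is `ℤ₂`-orientable"). [cite: Hatcher2002, §3.3  p. 235: "every manifold is  ℤ₂ -or] -/
def isOrientableOver_zmod_two : Prop :=
  ∀ {n : ℕ} [T2Space X] [ChartedSpace (EuclideanSpace ℝ (Fin n)) X],
    IsOrientableOver (ZMod 2) X n

/-- A simply connected topological `n`-manifold is `ℤ`-orientable (Hatcher 2002, §3.3, Prop. 3.25
and the sentence following it: the orientation double cover of a simply connected manifold is
trivial). [cite: Hatcher2002, §3.3  Prop. 3.25 and the sentence follow] -/
def isOrientableOver_int_of_simplyConnectedSpace : Prop :=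
  ∀ {n : ℕ} [T2Space X] [ChartedSpace (EuclideanSpace ℝ (Fin n)) X] [SimplyConnectedSpace X],
    IsOrientableOver ℤ X n

/-- Two `R`-orientations of a connected topological `n`-manifold which agree at one point are equal
(Hatcher 2002, §3.3, p. 234–235: the set where two orientations agree is open and closed, via the
covering space `M_R → M`, Lemma 3.27 ff.). [cite: Hatcher2002, §3.3  p. 234–235: the set where two orie] -/
def HomologicalOrientation.ext_of_connected : Prop :=
  ∀ {n : ℕ} [T2Space X] [ChartedSpace (EuclideanSpace ℝ (Fin n)) X] [ConnectedSpace X] (μ ν : HomologicalOrientation R X n) (x : X) (h : μ.localClass x = ν.localClass x),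
    μ = ν

/-- A connected orientable topological `n`-manifold has exactly two `ℤ`-orientations, `μ` and `-μ`
(Hatcher 2002, §3.3, p. 234: "if `M` is connected and orientable, it has exactly two
orientations"). [cite: Hatcher2002, §3.3  p. 234: "if  M  is connected and o] -/
def HomologicalOrientation.eq_or_eq_neg_of_connected : Prop :=
  ∀ {n : ℕ} [T2Space X] [ChartedSpace (EuclideanSpace ℝ (Fin n)) X] [ConnectedSpace X] (μ ν : HomologicalOrientation ℤ X n),
    μ = ν ∨ μ = -ν

/-- A `ℤ`-orientable topological `n`-manifold is `R`-orientable for every commutative ring `R`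
(Hatcher 2002, §3.3, p. 235: "an orientable manifold is `R`-orientable for all `R`", via the map
`Hₙ(M | x; ℤ) ⊗ R → Hₙ(M | x; R)`). [cite: Hatcher2002, §3.3  p. 235: "an orientable manifold is] -/
def isOrientableOver_of_int : Prop :=
  ∀ {n : ℕ} [T2Space X] [ChartedSpace (EuclideanSpace ℝ (Fin n)) X] (h : IsOrientableOver ℤ X n),
    IsOrientableOver R X n

open unitInterval

/-! ### Proofs: uniqueness of orientations on connected manifolds -/

/-- The inclusion of complements `X ∖ K → X ∖ L` for `L ⊆ K`, as a continuous map of subtypes;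
the second component of the map of pairs `(X, X ∖ K) → (X, X ∖ L)` inducing `restrictLocal`
(Hatcher 2002, §3.3, p. 233). [cite: Hatcher2002, §3.3  p. 233] -/
abbrev complInclusion {K L : Set X} (h : L ⊆ K) : C((Kᶜ : Set X), (Lᶜ : Set X)) :=
  subsetRestrict (ContinuousMap.id X) (fun _ hx ↦ Set.compl_subset_compl.2 h hx)

/-- If the inclusion `X ∖ K ↪ X ∖ L` (`L ⊆ K`) admits a retraction `ρ` which is also a homotopy
inverse (i.e. `X ∖ K` is a deformation retract of `X ∖ L` in the weak sense), then the restriction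
map `Hₙ(X | K; M) ⟶ Hₙ(X | L; M)` is an isomorphism: the long exact sequences of the pairs
`(X, X ∖ K)` and `(X, X ∖ L)` are compared by the five lemma, the outer maps being isomorphisms by
homotopy invariance (Hatcher 2002, §3.3, p. 234, the "canonical isomorphisms
`Hₙ(ℝⁿ | x) ≈ Hₙ(ℝⁿ | B)`"; §2.1, Prop. 2.19 ff. and the five lemma).
[cite: Hatcher2002, §3.3  p. 234] -/
theorem isIso_restrictLocal_of_retract {K L : Set X} (h : L ⊆ K)
    (ρ : C((Lᶜ : Set X), (Kᶜ : Set X))) (h₁ : ρ.comp (complInclusion h) = ContinuousMap.id _)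
    (h₂ : ((complInclusion h).comp ρ).Homotopic (ContinuousMap.id _)) (n : ℕ) :
    IsIso (restrictLocal R M h n) := by
  have hS₁ := relativeSingularChainComplex.shortExact_subsetι_π R M X Kᶜ
  have hS₂ := relativeSingularChainComplex.shortExact_subsetι_π R M X Lᶜ
  have hKL : Set.MapsTo (ContinuousMap.id X) Kᶜ Lᶜ := fun _ hx ↦ Set.compl_subset_compl.2 h hx
  let φ := relativeSingularChainComplex.shortComplexMap R M (ContinuousMap.id X) hKL
  have hτ₁ : ∀ k, IsIso (HomologicalComplex.homologyMap φ.τ₁ k) := fun k ↦ by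
    change IsIso (singularHomology.map R M (complInclusion h) k)
    refine ⟨⟨singularHomology.map R M ρ k, ?_, ?_⟩⟩
    · rw [← singularHomology.map_comp, h₁, singularHomology.map_id]
    · rw [← singularHomology.map_comp, singularHomology.map_eq_of_homotopic R M h₂,
        singularHomology.map_id]
  have hτ₂ : ∀ k, IsIso (HomologicalComplex.homologyMap φ.τ₂ k) := fun k ↦ by
    change IsIso (singularHomology.map R M (ContinuousMap.id X) k)
    rw [singularHomology.map_id]
    infer_instance
  change IsIso (HomologicalComplex.homologyMap φ.τ₃ n)
  haveI := hτ₂ n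
  exact HomologicalComplex.HomologySequence.isIso_homologyMap_τ₃ φ hS₁ hS₂ n inferInstance
    (hτ₂ n) (fun j _ ↦ hτ₁ j) (fun j _ ↦ inferInstance)

/-- Restricting first to `L ⊆ K` and then to a point `y ∈ L` is restricting to `y ∈ K`
(Hatcher 2002, §3.3, naturality of the maps `Hₙ(M | B) → Hₙ(M | y)`). [cite: Hatcher2002, §3.3] -/
lemma restrictToPoint_restrictLocal_apply {K L : Set X} (h : L ⊆ K) {y : X} (hy : y ∈ L) (n : ℕ)
    (a : localHomologyOfSet R M X K n) :
    restrictToPoint R M hy n (restrictLocal R M h n a) = restrictToPoint R M (h hy) n a := by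
  rw [restrictToPoint, restrictToPoint, ← ModuleCat.comp_apply, restrictLocal_comp]

namespace HomologicalOrientation

variable {R} {n : ℕ}

/-- Two local orientations at the same point differ by a unit of `R`: if `μₓ` and `νₓ` are both
generators of `Hₙ(X | x; R) ≅ R` then `μₓ = u • νₓ` for a unit `u ∈ Rˣ` (Hatcher 2002, §3.3,
p. 235: a generator of `R` is a unit, "since we assume `R` has an identity element").
[cite: Hatcher2002, §3.3  p. 235] -/
theorem exists_isUnit_smul (μ ν : HomologicalOrientation R X n) (x : X) :
    ∃ u : R, IsUnit u ∧ μ.localClass x = u • ν.localClass x := by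
  obtain ⟨e, he⟩ := ν.isGenerator x
  obtain ⟨e', he'⟩ := μ.isGenerator x
  refine ⟨e (μ.localClass x), ?_, ?_⟩
  · let f : R ≃ₗ[R] R := e'.symm.trans e
    have hf : ∀ r, f r = r * f 1 := fun r ↦ by
      rw [← smul_eq_mul, ← map_smul, smul_eq_mul, mul_one]
    have h1 : f 1 = e (μ.localClass x) := by
      simp only [f, LinearEquiv.trans_apply, ← he', LinearEquiv.symm_apply_apply]
    refine IsUnit.of_mul_eq_one (f.symm 1) ?_
    rw [← h1, mul_comm, ← hf, LinearEquiv.apply_symm_apply]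
  · apply e.injective
    rw [map_smul, he, smul_eq_mul, mul_one]

end HomologicalOrientation

section Radial

variable {E : Type*} [NormedAddCommGroup E] [NormedSpace ℝ E]

/-- The straight-line deformation of a punctured ball onto its boundary sphere, in coordinates:
`radialDeformation p r t v = p + ((1 - t) · r/‖v - p‖ + t) · (v - p)`, which is the radial
projection of `v ≠ p` to the sphere of radius `r` about `p` at `t = 0` and `v` itself at `t = 1`
(Hatcher 2002, §3.3, p. 231/234: `ℝⁿ - B` is a deformation retract of `ℝⁿ - {x}`, giving
`Hₙ(ℝⁿ | B) ≈ Hₙ(ℝⁿ | x)`). [cite: Hatcher2002, §3.3  p. 234] -/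
def radialDeformation (p : E) (r t : ℝ) (v : E) : E :=
  p + ((1 - t) * (r / ‖v - p‖) + t) • (v - p)

/-- `radialDeformation p r t v - p` is the rescaled offset `((1 - t) r/‖v - p‖ + t) • (v - p)`
(elementary). [folklore] -/
lemma radialDeformation_sub (p : E) (r t : ℝ) (v : E) :
    radialDeformation p r t v - p = ((1 - t) * (r / ‖v - p‖) + t) • (v - p) :=
  add_sub_cancel_left _ _

/-- Points on the sphere `‖v - p‖ = r` are fixed by the radial deformation at all times
(elementary). [folklore] -/
lemma radialDeformation_of_norm_eq {p : E} {r : ℝ} (hr : r ≠ 0) (t : ℝ) {v : E}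
    (hv : ‖v - p‖ = r) : radialDeformation p r t v = v := by
  rw [radialDeformation, hv, div_self hr, mul_one, sub_add_cancel, one_smul, add_sub_cancel]

/-- At time `t = 1` the radial deformation is the identity (elementary). [folklore] -/
lemma radialDeformation_one (p : E) (r : ℝ) (v : E) : radialDeformation p r 1 v = v := by
  simp [radialDeformation]

/-- For `v ≠ p` in the closed ball and `t ∈ [0, 1]`, the deformed point has distance
`(1 - t) r + t ‖v - p‖` from `p` (elementary). [folklore] -/
lemma norm_radialDeformation_sub {p : E} {r t : ℝ} {v : E} (ht₀ : 0 ≤ t) (ht₁ : t ≤ 1)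
    (hv : v ≠ p) (hvr : ‖v - p‖ ≤ r) :
    ‖radialDeformation p r t v - p‖ = (1 - t) * r + t * ‖v - p‖ := by
  have hd : 0 < ‖v - p‖ := norm_pos_iff.2 (sub_ne_zero.2 hv)
  rw [radialDeformation_sub, norm_smul, Real.norm_of_nonneg, add_mul, mul_assoc,
    div_mul_cancel₀ _ hd.ne']
  exact add_nonneg (mul_nonneg (sub_nonneg.2 ht₁) (div_nonneg (hd.le.trans hvr) hd.le)) ht₀

/-- The radial deformation stays in the closed ball of radius `r` (elementary). [folklore] -/
lemma norm_radialDeformation_sub_le {p : E} {r t : ℝ} {v : E} (ht₀ : 0 ≤ t) (ht₁ : t ≤ 1)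
    (hv : v ≠ p) (hvr : ‖v - p‖ ≤ r) : ‖radialDeformation p r t v - p‖ ≤ r := by
  rw [norm_radialDeformation_sub ht₀ ht₁ hv hvr]
  nlinarith

/-- The radial deformation does not decrease the distance to the centre (elementary). [folklore] -/
lemma le_norm_radialDeformation_sub {p : E} {r t : ℝ} {v : E} (ht₀ : 0 ≤ t) (ht₁ : t ≤ 1)
    (hv : v ≠ p) (hvr : ‖v - p‖ ≤ r) : ‖v - p‖ ≤ ‖radialDeformation p r t v - p‖ := by
  rw [norm_radialDeformation_sub ht₀ ht₁ hv hvr]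
  nlinarith

/-- The radial deformation of `v ≠ p` never hits the centre `p` (elementary). [folklore] -/
lemma radialDeformation_ne {p : E} {r t : ℝ} {v : E} (ht₀ : 0 ≤ t) (ht₁ : t ≤ 1)
    (hv : v ≠ p) (hvr : ‖v - p‖ ≤ r) : radialDeformation p r t v ≠ p := by
  intro h
  have := le_norm_radialDeformation_sub ht₀ ht₁ hv hvr
  rw [h, sub_self, norm_zero, norm_le_zero_iff, sub_eq_zero] at this
  exact hv this

/-- The radial deformation is jointly continuous in `(t, v)` away from the centre `v = p`
(elementary). [folklore] -/
lemma continuousOn_radialDeformation (p : E) (r : ℝ) :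
    ContinuousOn (fun z : ℝ × E ↦ radialDeformation p r z.1 z.2) {z | z.2 ≠ p} := by
  refine continuousOn_const.add (ContinuousOn.smul ?_ (continuousOn_snd.sub continuousOn_const))
  refine (((continuousOn_const.sub continuousOn_fst).mul (continuousOn_const.div
    (continuousOn_snd.sub continuousOn_const).norm ?_)).add continuousOn_fst)
  exact fun z hz ↦ (norm_pos_iff.2 (sub_ne_zero.2 hz)).ne'

end Radial

section ChartBall

variable [T2Space X] (E : Type*) [NormedAddCommGroup E] [NormedSpace ℝ E] [ProperSpace E]
  [ChartedSpace E X]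

include E

/-- **Chart balls.** In a Hausdorff space charted over a proper real normed space `E` (e.g. a
topological `n`-manifold, `E = ℝⁿ`), every neighbourhood `U` of a point `x` contains an open
neighbourhood `B` of `x` (the preimage of a small open chart ball about `x`) such that `X ∖ B` is a
deformation retract of `X ∖ {x}`: there is a retraction `ρ : X ∖ {x} → X ∖ B` of the inclusion
which is a homotopy inverse to it (radial deformation inside the closed chart ball, the identity
outside). This is the geometric input for the canonical isomorphisms `Hₙ(M | B) ≈ Hₙ(M | x)`
(Hatcher 2002, §3.3, p. 234). [cite: Hatcher2002, §3.3  p. 234] -/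
theorem exists_isOpen_retract_compl (x : X) {U : Set X} (hU : U ∈ 𝓝 x) :
    ∃ B : Set X, ∃ hxB : x ∈ B, IsOpen B ∧ B ⊆ U ∧ ∃ ρ : C(({x}ᶜ : Set X), (Bᶜ : Set X)),
      ρ.comp (complInclusion (Set.singleton_subset_iff.2 hxB)) = ContinuousMap.id _ ∧
      ((complInclusion (Set.singleton_subset_iff.2 hxB)).comp ρ).Homotopic
        (ContinuousMap.id _) := by
  classical
  set c := chartAt E x with hc
  set p : E := c x with hp
  have hxc : x ∈ c.source := mem_chart_source E x
  have hpt : p ∈ c.target := mem_chart_target E x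
  have hW : c.target ∩ c.symm ⁻¹' U ∈ 𝓝 p :=
    Filter.inter_mem (chart_target_mem_nhds E x)
      ((c.continuousAt_symm hpt).preimage_mem_nhds (by rwa [c.left_inv hxc]))
  obtain ⟨r, hr, hrW⟩ := Metric.nhds_basis_closedBall.mem_iff.1 hW
  have hrt : Metric.closedBall p r ⊆ c.target := hrW.trans Set.inter_subset_left
  have hrU : ∀ v ∈ Metric.closedBall p r, c.symm v ∈ U := fun v hv ↦ (hrW hv).2
  set B := c.source ∩ c ⁻¹' Metric.ball p r with hB
  set D := c.source ∩ c ⁻¹' Metric.closedBall p r with hD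
  have hBo : IsOpen B := c.isOpen_inter_preimage Metric.isOpen_ball
  have hxB : x ∈ B := ⟨hxc, Metric.mem_ball_self hr⟩
  have hBD : B ⊆ D := fun y hy ↦ ⟨hy.1, Metric.ball_subset_closedBall hy.2⟩
  have hDc : IsClosed D := by
    rw [hD, ← c.symm_image_eq_source_inter_preimage hrt]
    exact ((isCompact_closedBall p r).image_of_continuousOn
      (c.continuousOn_symm.mono hrt)).isClosed
  have hnorm : ∀ y ∈ D, ‖c y - p‖ ≤ r := fun y hy ↦ by
    rw [← dist_eq_norm]; exact hy.2
  have hne : ∀ y ∈ D, y ≠ x → c y ≠ p := fun y hy hyx h ↦ hyx (c.injOn hy.1 hxc h)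
  have hsphere : ∀ y ∈ D, y ∉ B → ‖c y - p‖ = r := fun y hy hyB ↦
    le_antisymm (hnorm y hy) (by
      rw [← dist_eq_norm]; exact not_lt.1 fun h ↦ hyB ⟨hy.1, h⟩)
  -- the deformation of `X ∖ {x}` onto `X ∖ B`
  let F : I × X → X := fun z ↦
    if z.2 ∈ D then c.symm (radialDeformation p r z.1 (c z.2)) else z.2
  have hFD : ∀ (t : I) (y : X), y ∈ D → F (t, y) = c.symm (radialDeformation p r t (c y)) :=
    fun t y hy ↦ if_pos hy
  have hFD' : ∀ (t : I) (y : X), y ∉ D → F (t, y) = y := fun t y hy ↦ if_neg hy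
  have hmem : ∀ (t : I), ∀ y ∈ D, y ≠ x →
      radialDeformation p r t (c y) ∈ Metric.closedBall p r := fun t y hy hyx ↦ by
    rw [Metric.mem_closedBall, dist_eq_norm]
    exact norm_radialDeformation_sub_le t.2.1 t.2.2 (hne y hy hyx) (hnorm y hy)
  have hFx : ∀ (t : I) (y : X), y ≠ x → F (t, y) ≠ x := by
    intro t y hyx
    by_cases hy : y ∈ D
    · rw [hFD t y hy]
      intro h
      have := congrArg c h
      rw [c.right_inv (hrt (hmem t y hy hyx))] at this
      exact radialDeformation_ne t.2.1 t.2.2 (hne y hy hyx) (hnorm y hy) this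
    · rwa [hFD' t y hy]
  have hF0 : ∀ y : X, y ≠ x → F (0, y) ∉ B := by
    intro y hyx
    by_cases hy : y ∈ D
    · rw [hFD 0 y hy]
      rintro ⟨-, h⟩
      rw [Set.mem_preimage, c.right_inv (hrt (hmem 0 y hy hyx)), Metric.mem_ball, dist_eq_norm,
        norm_radialDeformation_sub (t := ((0 : I) : ℝ)) le_rfl zero_le_one (hne y hy hyx)
          (hnorm y hy)] at h
      simp at h
    · rw [hFD' 0 y hy]
      exact fun h ↦ hy (hBD h)
  have hF0' : ∀ y : X, y ∉ B → F (0, y) = y := by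
    intro y hyB
    by_cases hy : y ∈ D
    · rw [hFD 0 y hy, radialDeformation_of_norm_eq hr.ne' _ (hsphere y hy hyB), c.left_inv hy.1]
    · exact hFD' 0 y hy
  have hF1 : ∀ y : X, F (1, y) = y := by
    intro y
    by_cases hy : y ∈ D
    · rw [hFD 1 y hy, Set.Icc.coe_one, radialDeformation_one, c.left_inv hy.1]
    · exact hFD' 1 y hy
  have hFc : ContinuousOn F {z | z.2 ≠ x} := by
    apply ContinuousOn.if
    · rintro ⟨t, y⟩ ⟨hyx : y ≠ x, hfr⟩
      have hyD : y ∈ D := frontier_subset_iff_isClosed.2 (hDc.preimage continuous_snd) hfr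
      have hyB : y ∉ B := fun h ↦
        hfr.2 (interior_maximal (s := {a : I × X | a.2 ∈ D}) (t := Prod.snd ⁻¹' B)
          (fun z hz ↦ hBD hz) (hBo.preimage continuous_snd) h)
      simp only
      rw [radialDeformation_of_norm_eq hr.ne' _ (hsphere y hyD hyB), c.left_inv hyD.1]
    · have hcl : closure {a : I × X | a.2 ∈ D} = {a | a.2 ∈ D} :=
        (hDc.preimage continuous_snd).closure_eq
      rw [hcl]
      refine c.continuousOn_symm.comp ((continuousOn_radialDeformation p r).comp
        ((continuous_subtype_val.comp continuous_fst).continuousOn.prodMk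
          (c.continuousOn.comp continuousOn_snd fun z hz ↦ hz.2.1)) ?_) ?_
      · exact fun z hz ↦ hne z.2 hz.2 hz.1
      · exact fun z hz ↦ hrt (hmem z.1 z.2 hz.2 hz.1)
    · exact continuousOn_snd
  -- assemble
  refine ⟨B, hxB, hBo, fun y hy ↦ ?_, ?_⟩
  · have := hrU (c y) (Metric.ball_subset_closedBall hy.2)
    rwa [c.left_inv hy.1] at this
  let ρ : C(({x}ᶜ : Set X), (Bᶜ : Set X)) :=
    ⟨fun y ↦ ⟨F (0, y), hF0 y y.2⟩,
      (hFc.comp_continuous (continuous_const.prodMk continuous_subtype_val)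
        fun y ↦ y.2).subtype_mk _⟩
  refine ⟨ρ, ContinuousMap.ext fun y ↦ Subtype.ext (hF0' y y.2), ⟨?_⟩⟩
  exact
    { toFun := fun z ↦ ⟨F (z.1, z.2), hFx z.1 z.2 z.2.2⟩
      continuous_toFun := (hFc.comp_continuous
        (continuous_fst.prodMk (continuous_subtype_val.comp continuous_snd))
        fun z ↦ z.2.2).subtype_mk _
      map_zero_left := fun y ↦ rfl
      map_one_left := fun y ↦ Subtype.ext (hF1 y) }

/-- On a manifold (a Hausdorff space charted over a proper real normed space), every neighbourhood
of `x` contains an open neighbourhood `B ∋ x` for which all restriction maps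
`Hₖ(X | B; M) ⟶ Hₖ(X | x; M)` are isomorphisms (Hatcher 2002, §3.3, p. 234: the canonical
isomorphisms `Hₙ(M | B) ≈ Hₙ(ℝⁿ | B) ≈ Hₙ(ℝⁿ | x)` for a chart ball `B` about `x`; here obtained
without excision from the long exact sequences and the deformation retraction
`X ∖ {x} → X ∖ B`). [cite: Hatcher2002, §3.3  p. 234] -/
theorem exists_isOpen_isIso_restrictToPoint (x : X) {U : Set X} (hU : U ∈ 𝓝 x) :
    ∃ B : Set X, ∃ hxB : x ∈ B, IsOpen B ∧ B ⊆ U ∧ ∀ k, IsIso (restrictToPoint R M hxB k) := by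
  obtain ⟨B, hxB, hBo, hBU, ρ, h₁, h₂⟩ := exists_isOpen_retract_compl E x hU
  exact ⟨B, hxB, hBo, hBU, fun k ↦ isIso_restrictLocal_of_retract R M _ ρ h₁ h₂ k⟩

end ChartBall

/-! ### Uniqueness of orientations -/

namespace HomologicalOrientation

variable {R} {n : ℕ}

/-- **Unique continuation of local orientations.** On a topological `n`-manifold, if two
`R`-orientations satisfy `μₓ = u • νₓ` at a point `x`, then `μ_y = u • ν_y` for all `y` near `x`:
both are restrictions of classes on a chart ball `B` about `x`, and `Hₙ(X | B) → Hₙ(X | x)` is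
injective (Hatcher 2002, §3.3, p. 234–235: the sets `U(μ_B)` form a basis making `M_R → M` a
covering space). [cite: Hatcher2002, §3.3  p. 234–235] -/
theorem eventually_eq_smul [T2Space X] [ChartedSpace (EuclideanSpace ℝ (Fin n)) X]
    (μ ν : HomologicalOrientation R X n) {x : X} {u : R}
    (h : μ.localClass x = u • ν.localClass x) :
    ∀ᶠ y in 𝓝 x, μ.localClass y = u • ν.localClass y := by
  obtain ⟨K, hK, μK, hμK⟩ := μ.locallyConsistent x
  obtain ⟨K', hK', νK, hνK⟩ := ν.locallyConsistent x
  obtain ⟨B, hxB, hBo, hBU, hiso⟩ :=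
    exists_isOpen_isIso_restrictToPoint R R (EuclideanSpace ℝ (Fin n)) x (Filter.inter_mem hK hK')
  have hBK : B ⊆ K := hBU.trans Set.inter_subset_left
  have hBK' : B ⊆ K' := hBU.trans Set.inter_subset_right
  have key : restrictLocal R R hBK n μK = u • restrictLocal R R hBK' n νK := by
    haveI := hiso n
    apply (ModuleCat.mono_iff_injective (restrictToPoint R R hxB n)).1 inferInstance
    rw [map_smul, restrictToPoint_restrictLocal_apply, restrictToPoint_restrictLocal_apply,
      hμK x (hBK hxB), hνK x (hBK' hxB), h]
  filter_upwards [hBo.mem_nhds hxB] with y hy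
  rw [← hμK y (hBK hy), ← hνK y (hBK' hy), ← restrictToPoint_restrictLocal_apply R R hBK hy,
    ← restrictToPoint_restrictLocal_apply R R hBK' hy, key, map_smul]

/-- If `μ_y = u • ν_y` and also `μ_y = ν_y` then `u = 1`, because `ν_y` generates
`Hₙ(X | y; R) ≅ R` (Hatcher 2002, §3.3, p. 235). [cite: Hatcher2002, §3.3  p. 235] -/
lemma eq_one_of_smul_eq (ν : HomologicalOrientation R X n) (y : X) {u : R}
    (h : u • ν.localClass y = ν.localClass y) : u = 1 := by
  obtain ⟨e, he⟩ := ν.isGenerator y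
  have := congrArg e h
  rwa [map_smul, he, smul_eq_mul, mul_one] at this

variable (R X) in
/-- **Discharge of `HomologicalOrientation.ext_of_connected`.** Two `R`-orientations of a
connected topological `n`-manifold which agree at one point are equal: the set where they agree
is open (unique continuation, `eventually_eq_smul` with `u = 1`) and closed (where they differ,
`μ_y = u • ν_y` with a unit `u ≠ 1`, which also propagates), hence everything
(Hatcher 2002, §3.3, pp. 234–235: sections of the covering space `M_R → M`; proof of
Prop. 3.25). [cite: Hatcher2002, §3.3  pp. 234–235  proof of Prop. 3.25] -/
theorem ext_of_connected_holds : HomologicalOrientation.ext_of_connected R (X := X) := by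
  intro n _ _ _ μ ν x h
  let S : Set X := {y | μ.localClass y = ν.localClass y}
  have hSo : IsOpen S := isOpen_iff_mem_nhds.2 fun y (hy : μ.localClass y = ν.localClass y) ↦ by
    have := eventually_eq_smul μ ν (u := 1) (by rw [one_smul]; exact hy)
    filter_upwards [this] with z hz
    rw [one_smul] at hz
    exact hz
  have hSc : IsClosed S := by
    rw [← isOpen_compl_iff, isOpen_iff_mem_nhds]
    intro y hy
    obtain ⟨u, -, hyu⟩ := exists_isUnit_smul μ ν y
    filter_upwards [eventually_eq_smul μ ν hyu] with z hz (hz' : μ.localClass z = ν.localClass z)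
    have hu : u = 1 := eq_one_of_smul_eq ν z (hz.symm.trans hz')
    exact hy (show μ.localClass y = ν.localClass y by rw [hyu, hu, one_smul])
  have hS : S = Set.univ :=
    (isClopen_iff.1 ⟨hSc, hSo⟩).resolve_left (Set.nonempty_iff_ne_empty.1 ⟨x, h⟩)
  ext1
  funext y
  exact (Set.eq_univ_iff_forall.1 hS y : μ.localClass y = ν.localClass y)

/-- On a connected topological `n`-manifold, if the only units of `R` are `±1` then any two
`R`-orientations `μ, ν` satisfy `μ = ν` or `μ = -ν`: at any point `x`, `μₓ = u • νₓ` for a unit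
`u`, so `μ` agrees at `x` with `ν` or with `-ν`, and orientations of a connected manifold agreeing
at a point are equal (Hatcher 2002, §3.3, pp. 234–235, proof of Prop. 3.25; for `R = ℤ` this is
"if `M` is orientable, it has exactly two orientations since it is connected").
[cite: Hatcher2002, §3.3  proof of Prop. 3.25] -/
theorem eq_or_eq_neg_of_isUnit_imp [T2Space X] [ChartedSpace (EuclideanSpace ℝ (Fin n)) X]
    [ConnectedSpace X] (hR : ∀ u : R, IsUnit u → u = 1 ∨ u = -1)
    (μ ν : HomologicalOrientation R X n) : μ = ν ∨ μ = -ν := by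
  rcases isEmpty_or_nonempty X with hX | ⟨⟨x⟩⟩
  · exact Or.inl (HomologicalOrientation.ext (funext fun x ↦ isEmptyElim x))
  obtain ⟨u, hu, hxu⟩ := exists_isUnit_smul μ ν x
  rcases hR u hu with rfl | rfl
  · exact Or.inl (ext_of_connected_holds R X μ ν x (by rw [hxu, one_smul]))
  · exact Or.inr (ext_of_connected_holds R X μ (-ν) x (by rw [hxu, neg_one_smul, neg_localClass]))

variable (X) in
/-- **Discharge of `HomologicalOrientation.eq_or_eq_neg_of_connected`.** A connected topological
`n`-manifold has at most the two `ℤ`-orientations `ν` and `-ν` (Hatcher 2002, §3.3, pp. 234–235,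
proof of Prop. 3.25: "if `M` is orientable, it has exactly two orientations since it is
connected"); from `eq_or_eq_neg_of_isUnit_imp` and `ℤˣ = {1, -1}`.
[cite: Hatcher2002, §3.3  p. 234  proof of Prop. 3.25] -/
theorem eq_or_eq_neg_of_connected_holds :
    HomologicalOrientation.eq_or_eq_neg_of_connected (X := X) :=
  fun μ ν ↦ eq_or_eq_neg_of_isUnit_imp (fun _ hu ↦ Int.isUnit_iff.1 hu) μ ν

end HomologicalOrientation

end Literature.AlgebraicTopology.SingularHomology
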